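import Summits.AtomisticToContinuum.FouriersLaw.Theorems.HonestZwanzigRobinCoercivityFluxReduction
import Summits.AtomisticToContinuum.FouriersLaw.Theorems.HonestZwanzigRobinCoercivityStubGramDualityConverse

/-!
# `HonestZwanzig.RobinCoercivity` — the converse transfer: Robin coercivity implies the flux bound (line LinAlg)

Support file for the crux `stmt-AtomisticToContinuum-12695` (`RobinCoercivity` of route `HonestZwanzig`, sub-problem
`FouriersLaw`). Together with `robinCoercivity_of_fluxBound` (`…FluxReduction.lean`) this makes the line's reduction an
EQUIVALENCE: the crux holds iff the N-uniform flux bound (registered stub `stub_fluxBound`) holds.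

* `flux_fixedN` — at fixed `N ≥ 2`, `s > 0` (abstract gadgets with defining equations, fixed-`N` package, positivity of
  `Cov(e,e)` and `G(s)`): Robin coercivity of the Feshbach matrix with constant `c` gives the flux bound with constant `c⁻¹`
  (`𝔽 = χG⁻¹χ` by `stub_feshbachMatrix`, the Robin form is `|Bξ|²` by `stub_robinIncidence`, then the converse Gram
  duality `stub_gramDualityConverse`).
* `fluxBound_of_robinCoercivity` — hence `RobinCoercivity →` the N-uniform flux bound with `K = c⁻¹` and the same `s₀(N)`.
-/

noncomputable section

open MeasureTheory Finset Matrix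
open Literature.MathematicalPhysics.KineticTheory.HeatConduction
open Summit.AtomisticToContinuum.FouriersLaw.Theses.HonestZwanzig
open Summit.AtomisticToContinuum.FouriersLaw.Theorems.HonestZwanzig.NetworkReduction

namespace Summit.AtomisticToContinuum.FouriersLaw.Theorems.HonestZwanzig.Robin

/-! ### Fixed `N` and `s` -/

section FixedN

variable {ω₂ lam β γ : ℝ} {N : ℕ} {T : ℝ}
  {Adm : (PhaseSpace N → ℝ) → Prop}
  {corr : (PhaseSpace N → ℝ) → (PhaseSpace N → ℝ) → ℝ → ℝ}
  {lap : ℝ → (PhaseSpace N → ℝ) → (PhaseSpace N → ℝ) → ℝ}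
  {cov : (PhaseSpace N → ℝ) → (PhaseSpace N → ℝ) → ℝ}
  {e : Fin N → PhaseSpace N → ℝ}
  (hAdm : ∀ f, Adm f ↔ (Continuous f ∧ ∃ A : ℝ, ∀ z,
    |f z| ≤ A * Real.exp ((pinnedChain ω₂ lam β γ).hamiltonian N z / (8 * T))))
  (hcorr : ∀ f g t, corr f g t =
    (∫ z, f z * (∫ y, g y ∂((pinnedChain ω₂ lam β γ).transitionKernel N T T t.toNNReal z))
      ∂(pinnedChain ω₂ lam β γ).gibbsMeasure N T) -
    (∫ z, f z ∂(pinnedChain ω₂ lam β γ).gibbsMeasure N T) *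
      (∫ z, g z ∂(pinnedChain ω₂ lam β γ).gibbsMeasure N T))
  (hlap : ∀ s f g, lap s f g = ∫ t in Set.Ioi (0 : ℝ), Real.exp (-(s * t)) * corr f g t)
  (hcov : ∀ f g, cov f g = (∫ z, f z * g z ∂(pinnedChain ω₂ lam β γ).gibbsMeasure N T) -
    (∫ z, f z ∂(pinnedChain ω₂ lam β γ).gibbsMeasure N T) *
      (∫ z, g z ∂(pinnedChain ω₂ lam β γ).gibbsMeasure N T))
  (he : ∀ x z, e x z = z.2 x ^ 2 / 2 + (pinnedChain ω₂ lam β γ).U (z.1 x) +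
    ∑ j : Fin N, ((if j.val = x.val + 1 then (pinnedChain ω₂ lam β γ).V (z.1 j - z.1 x) / 2 else 0) +
      (if x.val = j.val + 1 then (pinnedChain ω₂ lam β γ).V (z.1 x - z.1 j) / 2 else 0)))
  (hFI : ∀ f g : PhaseSpace N → ℝ, Adm f → Adm g →
    Integrable f ((pinnedChain ω₂ lam β γ).gibbsMeasure N T) ∧
    (∀ t : ℝ, 0 ≤ t → Integrable (fun z => f z *
      (∫ y, g y ∂((pinnedChain ω₂ lam β γ).transitionKernel N T T t.toNNReal z)))
      ((pinnedChain ω₂ lam β γ).gibbsMeasure N T)) ∧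
    IntegrableOn (corr f g) (Set.Ioi 0) ∧
    (∀ t : ℝ, 0 ≤ t → corr f g t = corr (fun z => g (z.1, -z.2)) (fun z => f (z.1, -z.2)) t) ∧
    (∀ s : ℝ, 0 < s → ∀ x : Fin N,
      s * lap s (e x) g - cov (e x) g =
        lap s (fun z => (pinnedChain ω₂ lam β γ).generator N T T (e x) (z.1, -z.2)) g ∧
      s * lap s f (e x) - cov f (e x) = lap s f ((pinnedChain ω₂ lam β γ).generator N T T (e x))))
  (hGSE : ∀ (x : Fin N) (z : PhaseSpace N), (pinnedChain ω₂ lam β γ).generator N T T (e x) z =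
    (∑ b : Fin N, ((if x.val = b.val + 1 then (pinnedChain ω₂ lam β γ).bondCurrent N b z else 0) -
      (if b = x then (pinnedChain ω₂ lam β γ).bondCurrent N b z else 0))) +
    (if x.val = 0 then (pinnedChain ω₂ lam β γ).γ * (T - z.2 x ^ 2) else 0) +
    (if x.val = N - 1 then (pinnedChain ω₂ lam β γ).γ * (T - z.2 x ^ 2) else 0))
  (hPS : ∀ x y : Fin N, cov (e x) ((pinnedChain ω₂ lam β γ).generator N T T (e y)) =
    -(if x = y ∧ (x.val = 0 ∨ x.val = N - 1) then (pinnedChain ω₂ lam β γ).γ * T ^ 2 else 0))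
  (hω : 0 < ω₂) (hl : 0 ≤ lam) (hβ : 0 ≤ β) (hγ : 0 ≤ γ) (hT : 0 < T)

include hAdm hlap hcov hFI he hGSE hPS hω hl hβ hT in
/-- **The flux bound at fixed `N` and `s` from Robin coercivity.** Under the fixed-`N` package, positive definiteness of
`Cov(e,e)` and `G(s)`, and Robin coercivity of the Feshbach matrix with constant `c` at this `(N, s)`, every charge/flux pair
obeys `Σ_{x,y} a_x lap_s(e_x,e_y) a_y ≤ c⁻¹ (Σ_{b+1<N} ψ_b² + φ₀² + φ₁²)`. -/
theorem flux_fixedN (hN : 2 ≤ N) {s : ℝ} (hs : 0 < s)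
    (G : Matrix (Fin N) (Fin N) ℝ) (hG : ∀ x y, G x y = lap s (e x) (e y))
    (schur : (PhaseSpace N → ℝ) → (PhaseSpace N → ℝ) → ℝ)
    (hschur : ∀ f g, schur f g = lap s f g - ∑ x, ∑ y, lap s f (e x) * G⁻¹ x y * lap s (e y) g)
    (F : Fin N → Fin N → ℝ)
    (hF : ∀ x y, F x y = s * cov (e x) (e y) - cov (e x) ((pinnedChain ω₂ lam β γ).generator N T T (e y)) -
      schur (fun z => (pinnedChain ω₂ lam β γ).generator N T T (e x) (z.1, -z.2))
        ((pinnedChain ω₂ lam β γ).generator N T T (e y)))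
    (hGp : ∀ v : Fin N → ℝ, v ≠ 0 → 0 < ∑ x, ∑ y, v x * G x y * v y)
    (hCp : ∀ v : Fin N → ℝ, v ≠ 0 → 0 < ∑ x, ∑ y, v x * cov (e x) (e y) * v y)
    {c : ℝ} (hc : 0 < c)
    (hRobin : ∀ ξ : Fin N → ℝ, c * (∑ i : Fin N, ((∑ j : Fin N,
        if j.val = i.val + 1 then (ξ j - ξ i) ^ 2 else 0) + (if i.val = 0 then ξ i ^ 2 else 0) +
        (if i.val = N - 1 then ξ i ^ 2 else 0))) ≤ ∑ x, ∑ y, ξ x * F x y * ξ y)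
    (a ψ : Fin N → ℝ) (φ₀ φ₁ : ℝ)
    (hdiv : ∀ x : Fin N, ∑ y : Fin N, cov (e x) (e y) * a y =
        (∑ b : Fin N, if b.val + 1 < N then
          ((if x.val = b.val + 1 then ψ b else 0) - (if x = b then ψ b else 0)) else 0) +
        (if x.val = 0 then φ₀ else 0) + (if x.val = N - 1 then φ₁ else 0)) :
    ∑ x : Fin N, ∑ y : Fin N, a x * lap s (e x) (e y) * a y ≤
      c⁻¹ * ((∑ b : Fin N, if b.val + 1 < N then ψ b ^ 2 else 0) + φ₀ ^ 2 + φ₁ ^ 2) := by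
  classical
  -- the static covariance matrix
  set χ : Matrix (Fin N) (Fin N) ℝ := Matrix.of fun x y => cov (e x) (e y) with hχ
  have hχa : ∀ x y, χ x y = cov (e x) (e y) := fun x y => rfl
  have hGsym : ∀ x y, G x y = G y x := fun x y => by
    rw [hG, hG, pkg_G_symm hAdm hlap he hFI hω hl hβ hT s]
  have hχsym : ∀ x y, χ x y = χ y x := fun x y => by rw [hχa, hχa, cov_comm hcov]
  have hGpd : G.PosDef := posDef_of_symm_of_pos G hGsym hGp
  have hχpd : χ.PosDef := posDef_of_symm_of_pos χ hχsym (fun v hv => by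
    simpa only [hχa] using hCp v hv)
  -- (1) the Feshbach matrix is the Schur complement
  have hquad : ∀ ξ : Fin N → ℝ, ∑ x, ∑ y, ξ x * F x y * ξ y = (χ *ᵥ ξ) ⬝ᵥ (G⁻¹ *ᵥ (χ *ᵥ ξ)) := by
    intro ξ
    refine stub_feshbachMatrix s G χ (Matrix.of fun x y =>
        cov (e x) ((pinnedChain ω₂ lam β γ).generator N T T (e y)))
      (fun x y => lap s (fun z => (pinnedChain ω₂ lam β γ).generator N T T (e x) (z.1, -z.2)) (e y))
      (fun x y => lap s (e x) ((pinnedChain ω₂ lam β γ).generator N T T (e y)))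
      (fun x y => lap s (fun z => (pinnedChain ω₂ lam β γ).generator N T T (e x) (z.1, -z.2))
        ((pinnedChain ω₂ lam β γ).generator N T T (e y)))
      F hGpd hχsym (fun x y => ?_) (fun x y => ?_) (fun x y => ?_) (fun x y => ?_) ξ
    · rw [pkg_K1 hAdm he hFI hω hl hβ hT hs, hG, hχa]
    · rw [pkg_K2 hAdm he hFI hω hl hβ hT hs, hG, hχa]
    · rw [pkg_K3 hAdm hlap hcov he hFI hGSE hPS hω hl hβ hT hs, hG, hχa, Matrix.of_apply]
    · rw [hF, hschur, hχa, Matrix.of_apply]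
  -- (2) the Robin incidence matrix
  set B : Matrix (Fin N ⊕ Fin 2) (Fin N) ℝ := Matrix.of fun r x => Sum.elim
      (fun b : Fin N => if x.val = b.val + 1 then (1 : ℝ) else if x = b ∧ b.val + 1 < N then -1 else 0)
      (fun i : Fin 2 => if (i = 0 ∧ x.val = 0) ∨ (i = 1 ∧ x.val = N - 1) then (1 : ℝ) else 0) r with hBdef
  obtain ⟨hBrob, hBdiv, hBnorm⟩ := stub_robinIncidence hN B (fun r x => rfl)
  -- (3) Robin coercivity in matrix form
  have hRob' : ∀ ξ : Fin N → ℝ, c * ((B *ᵥ ξ) ⬝ᵥ (B *ᵥ ξ)) ≤ (χ *ᵥ ξ) ⬝ᵥ (G⁻¹ *ᵥ (χ *ᵥ ξ)) := by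
    intro ξ
    rw [hBrob ξ, ← hquad ξ]
    exact hRobin ξ
  -- (4) the flux, truncated past the last bond, as a vector on `Fin N ⊕ Fin 2`
  set ψ' : Fin N → ℝ := fun b => if b.val + 1 < N then ψ b else 0 with hψ'
  set w : Fin N ⊕ Fin 2 → ℝ := Sum.elim ψ' ![φ₀, φ₁] with hw
  have hψ'v : ∀ b : Fin N, b.val + 1 < N → ψ' b = ψ b := fun b hb => by simp only [hψ', if_pos hb]
  have haw : χ *ᵥ a = Bᵀ *ᵥ w := by
    funext x
    rw [hw, hBdiv ψ' ![φ₀, φ₁] x]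
    have h1 : (χ *ᵥ a) x = ∑ y : Fin N, cov (e x) (e y) * a y := by
      simp only [Matrix.mulVec, dotProduct, hχa]
    rw [h1, hdiv x]
    simp only [Matrix.cons_val_zero, Matrix.cons_val_one]
    congr 1
    congr 1
    refine Finset.sum_congr rfl fun b _ => ?_
    by_cases hb : b.val + 1 < N
    · rw [if_pos hb, if_pos hb, hψ'v b hb]
    · rw [if_neg hb, if_neg hb]
  have key := stub_gramDualityConverse B G χ hGpd hχpd hc hRob' a w haw
  have hlhs : a ⬝ᵥ (G *ᵥ a) = ∑ x : Fin N, ∑ y : Fin N, a x * lap s (e x) (e y) * a y := by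
    rw [← sum_sum_eq_dotProduct_mulVec]
    simp only [hG]
  have hrhs : w ⬝ᵥ w = (∑ b : Fin N, if b.val + 1 < N then ψ b ^ 2 else 0) + φ₀ ^ 2 + φ₁ ^ 2 := by
    rw [hw, hBnorm ψ' ![φ₀, φ₁]]
    simp only [Matrix.cons_val_zero, Matrix.cons_val_one]
    congr 1
    congr 1
    refine Finset.sum_congr rfl fun b _ => ?_
    by_cases hb : b.val + 1 < N
    · rw [if_pos hb, hψ'v b hb]
    · rw [if_neg hb]
      simp only [hψ', if_neg hb]
      ring
  rw [hlhs, hrhs] at key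
  exact key

end FixedN

/-! ### The N-uniform flux bound from the crux -/

/-- **The crux implies the N-uniform flux bound** (converse transfer of line LinAlg): if `RobinCoercivity` holds with
constant `c`, then for every `N ≥ 2` and `0 < s < s₀(N)` every charge/flux pair obeys the flux bound with `K = c⁻¹`.
With `robinCoercivity_of_fluxBound` this shows that the crux is EQUIVALENT to the registered stub `stub_fluxBound`. -/
theorem fluxBound_of_robinCoercivity : RobinCoercivity → ∀ ω₂ lam β γ : ℝ, 0 < ω₂ → 0 < lam → 0 < β → 0 < γ → ∀ T : ℝ, 0 < T →
    ∃ K : ℝ, 0 < K ∧ ∀ N : ℕ, 2 ≤ N → ∃ s₀ : ℝ, 0 < s₀ ∧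
    ∀ (lap : ℝ → (PhaseSpace N → ℝ) → (PhaseSpace N → ℝ) → ℝ)
      (cov : (PhaseSpace N → ℝ) → (PhaseSpace N → ℝ) → ℝ) (e : Fin N → PhaseSpace N → ℝ),
    (∀ s f g, lap s f g = ∫ t in Set.Ioi (0 : ℝ), Real.exp (-(s * t)) *
      ((∫ z, f z * (∫ y, g y ∂((pinnedChain ω₂ lam β γ).transitionKernel N T T t.toNNReal z))
          ∂(pinnedChain ω₂ lam β γ).gibbsMeasure N T) -
        (∫ z, f z ∂(pinnedChain ω₂ lam β γ).gibbsMeasure N T) *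
          (∫ z, g z ∂(pinnedChain ω₂ lam β γ).gibbsMeasure N T))) →
    (∀ f g, cov f g = (∫ z, f z * g z ∂(pinnedChain ω₂ lam β γ).gibbsMeasure N T) -
      (∫ z, f z ∂(pinnedChain ω₂ lam β γ).gibbsMeasure N T) *
        (∫ z, g z ∂(pinnedChain ω₂ lam β γ).gibbsMeasure N T)) →
    (∀ x z, e x z = z.2 x ^ 2 / 2 + (pinnedChain ω₂ lam β γ).U (z.1 x) +
      ∑ j : Fin N, ((if j.val = x.val + 1 then (pinnedChain ω₂ lam β γ).V (z.1 j - z.1 x) / 2 else 0) +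
        (if x.val = j.val + 1 then (pinnedChain ω₂ lam β γ).V (z.1 x - z.1 j) / 2 else 0))) →
    ∀ s : ℝ, 0 < s → s < s₀ → ∀ (a ψ : Fin N → ℝ) (φ₀ φ₁ : ℝ),
      (∀ x : Fin N, ∑ y : Fin N, cov (e x) (e y) * a y =
        (∑ b : Fin N, if b.val + 1 < N then
          ((if x.val = b.val + 1 then ψ b else 0) - (if x = b then ψ b else 0)) else 0) +
        (if x.val = 0 then φ₀ else 0) + (if x.val = N - 1 then φ₁ else 0)) →
      ∑ x : Fin N, ∑ y : Fin N, a x * lap s (e x) (e y) * a y ≤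
        K * ((∑ b : Fin N, if b.val + 1 < N then ψ b ^ 2 else 0) + φ₀ ^ 2 + φ₁ ^ 2) := by
  intro hRC ω₂ lam β γ hω hl hβ hγ T hT
  obtain ⟨c, hc, hcN⟩ := hRC ω₂ lam β γ hω hl hβ hγ T hT
  refine ⟨c⁻¹, inv_pos.2 hc, fun N hN => ?_⟩
  obtain ⟨s₀, hs₀, hRob⟩ := hcN N hN
  refine ⟨s₀, hs₀, ?_⟩
  intro lap cov e hlap hcov he
  obtain rfl : lap = fun s f g => ∫ t in Set.Ioi (0 : ℝ), Real.exp (-(s * t)) *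
      ((∫ z, f z * (∫ y, g y ∂((pinnedChain ω₂ lam β γ).transitionKernel N T T t.toNNReal z))
          ∂(pinnedChain ω₂ lam β γ).gibbsMeasure N T) -
        (∫ z, f z ∂(pinnedChain ω₂ lam β γ).gibbsMeasure N T) *
          (∫ z, g z ∂(pinnedChain ω₂ lam β γ).gibbsMeasure N T)) :=
    funext fun s => funext fun f => funext fun g => hlap s f g
  obtain rfl : cov = fun f g => (∫ z, f z * g z ∂(pinnedChain ω₂ lam β γ).gibbsMeasure N T) -
      (∫ z, f z ∂(pinnedChain ω₂ lam β γ).gibbsMeasure N T) *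
        (∫ z, g z ∂(pinnedChain ω₂ lam β γ).gibbsMeasure N T) := funext fun f => funext fun g => hcov f g
  obtain rfl : e = fun x z => z.2 x ^ 2 / 2 + (pinnedChain ω₂ lam β γ).U (z.1 x) +
      ∑ j : Fin N, ((if j.val = x.val + 1 then (pinnedChain ω₂ lam β γ).V (z.1 j - z.1 x) / 2 else 0) +
        (if x.val = j.val + 1 then (pinnedChain ω₂ lam β γ).V (z.1 x - z.1 j) / 2 else 0)) :=
    funext fun x => funext fun z => he x z
  intro s hs hss a ψ φ₀ φ₁ hdiv
  dsimp only at hRob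
  obtain ⟨-, hFI2, hCp, hGp⟩ := stub_feshbachIdentities ω₂ lam β γ hω hl hβ hγ T hT N hN
  exact flux_fixedN (ω₂ := ω₂) (lam := lam) (β := β) (γ := γ) (N := N) (T := T)
    (corr := fun f g t => (∫ z, f z * (∫ y, g y ∂((pinnedChain ω₂ lam β γ).transitionKernel N T T
      t.toNNReal z)) ∂(pinnedChain ω₂ lam β γ).gibbsMeasure N T) -
      (∫ z, f z ∂(pinnedChain ω₂ lam β γ).gibbsMeasure N T) * (∫ z, g z ∂(pinnedChain ω₂ lam β γ).gibbsMeasure N T))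
    (fun f => Iff.rfl) (fun s f g => rfl) (fun f g => rfl) (fun x z => rfl)
    hFI2 (fun x z => generatorSiteEnergy_proof ω₂ lam β γ N hN T T x z)
    (fun x y => ((parityStatics_proof ω₂ lam β γ hω hl hβ hγ T hT N hN) x).2 y)
    hω hl.le hβ.le hT hN hs _ (fun x y => rfl) _ (fun f g => rfl) _ (fun x y => rfl)
    (hGp s hs) hCp hc (hRob s hs hss) a ψ φ₀ φ₁ hdiv

end Summit.AtomisticToContinuum.FouriersLaw.Theorems.HonestZwanzig.Robin

end
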